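import Mathlib
import Literature.NumberTheory.Transcendental.KZCalculus
import Literature.NumberTheory.Transcendental.KZSemialgebraicComplex
import Literature.NumberTheory.Transcendental.SemialgebraicMapsProofs
import Literature.NumberTheory.Transcendental.EllIterRep
import Summits.KontsevichZagierPeriods.KontsevichZagierPeriods.Theses.TorsionLogs

/-!
# Route TorsionLogs — support item `GKZLevelThreePair`: the T-chain, the substitution `2r√r/(1+r³)`

Helper file for item `stmt-KontsevichZagierPeriods-13812` (`GKZLevelThreePair`), blueprint v3. The
rational-in-`√r` map `φ(r) = 2r√r/(1+r³)` plays two roles in the explicit chain carrying the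
2-dimensional factor `Trep` (value `T = 6 log 2`) of the level-3 Euler representation to
`[(1,2), 6/x]`: it is the upper edge `s ≤ φ(x)` of the band produced by the affine chart
`y = s(x³+1)/(2x√x)` of the hyperelliptic model `Y² = x⁶ + 2(1-2y²)x³ + 1`, and it is the final
one-dimensional substitution `s = φ(r)` (step (N4)). This file records its calculus:

* `hasDerivAt_tailSubst` — `φ'(q²) = 3q(1-q⁶)/(1+q⁶)²`;
* `tailSubst_data` — at `r = q²`: `0 < φ < 1`, `√(1-φ²) = (1-q⁶)/(1+q⁶)`, `(1-√(1-φ²))/φ = q³`, and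
  the pull-back identity `3((q³)^{-1/3} - (q³)^{1/3})/√(1-φ²) · φ' = 9(1-q²)/(1+q⁶)`;
* `strictMonoOn_tailSubst`, `image_tailSubst` (`φ` is an increasing bijection of `(0,1)`),
  `isSemialgebraicFunOn_tailSubst`.

## References

* M. Kontsevich, D. Zagier, *Periods* (2001), §1.2 rule (2).
-/

-- `Summit.<Summit>.<Sub>` with Sub = Summit (single-conjunct summit, D-0017) duplicates the segment.
set_option linter.dupNamespace false

noncomputable section

namespace Summit.KontsevichZagierPeriods.KontsevichZagierPeriods.Theorems.GKZLevelThree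

open Set MeasureTheory
open MvPolynomial (aeval X C)
open Literature.NumberTheory.Transcendental Literature.NumberTheory.Transcendental.KZ
open Literature.ModelTheory.ExponentialFields (IsSemialgebraic isSemialgebraic_setOf_eval_pos)

/-- `1 + r³ ≠ 0` for `0 ≤ r`. -/
theorem one_add_cube_ne_zero {r : ℝ} (hr : 0 ≤ r) : (1:ℝ) + r ^ 3 ≠ 0 := by positivity

/-! ## The substitution `s = φ(r) = 2r√r/(1+r³)` -/

/-- `φ(q²) = 2q³/(1+q⁶)` has derivative `3q(1-q⁶)/(1+q⁶)²` at `r = q²` (`q > 0`). -/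
theorem hasDerivAt_tailSubst {q : ℝ} (hq : 0 < q) :
    HasDerivAt (fun r : ℝ => 2 * (r * Real.sqrt r) / (1 + r ^ 3))
      (3 * q * (1 - q ^ 6) / (1 + q ^ 6) ^ 2) (q ^ 2) := by
  have hq2 : 0 < q ^ 2 := by positivity
  have hsq : Real.sqrt (q ^ 2) = q := Real.sqrt_sq hq.le
  have h1 : HasDerivAt (fun r : ℝ => r * Real.sqrt r) (1 * Real.sqrt (q ^ 2) + q ^ 2 * (1 / (2 * Real.sqrt (q ^ 2))))
      (q ^ 2) := (hasDerivAt_id' (q ^ 2)).mul (Real.hasDerivAt_sqrt hq2.ne')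
  have h2 : HasDerivAt (fun r : ℝ => 2 * (r * Real.sqrt r))
      (2 * (1 * Real.sqrt (q ^ 2) + q ^ 2 * (1 / (2 * Real.sqrt (q ^ 2))))) (q ^ 2) := h1.const_mul 2
  have h3 : HasDerivAt (fun r : ℝ => 1 + r ^ 3) (0 + (3:ℕ) * (q ^ 2) ^ (3 - 1)) (q ^ 2) :=
    (hasDerivAt_const _ _).add (hasDerivAt_pow 3 (q ^ 2))
  have hden : (1 + (q ^ 2) ^ 3) ≠ 0 := by positivity
  refine (h2.div h3 hden).congr_deriv ?_
  rw [hsq]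
  have hq0 : q ≠ 0 := hq.ne'
  field_simp
  ring

/-- The pull-back data of the substitution at `r = q²`, `0 < q < 1`: with `s = 2q³/(1+q⁶)` one has
`0 < s < 1`, `√(1-s²) = (1-q⁶)/(1+q⁶)`, `(1-√(1-s²))/s = q³`, and
`3((q³)^{-1/3} - (q³)^{1/3})/√(1-s²) · 3q(1-q⁶)/(1+q⁶)² = 9(1-q²)/(1+q⁶)`. -/
theorem tailSubst_data {q : ℝ} (hq : 0 < q) (hq1 : q < 1) :
    let s : ℝ := 2 * (q ^ 2 * q) / (1 + (q ^ 2) ^ 3)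
    0 < s ∧ s < 1 ∧ Real.sqrt (1 - s ^ 2) = (1 - q ^ 6) / (1 + q ^ 6) ∧
      (1 - Real.sqrt (1 - s ^ 2)) / s = q ^ 3 ∧
      3 * ((q ^ 3) ^ (-(1:ℝ) / 3) - (q ^ 3) ^ ((1:ℝ) / 3)) / ((1 - q ^ 6) / (1 + q ^ 6)) *
        (3 * q * (1 - q ^ 6) / (1 + q ^ 6) ^ 2) = 9 * (1 - q ^ 2) / (1 + (q ^ 2) ^ 3) := by
  intro s
  have hq6 : q ^ 6 < 1 := by
    calc q ^ 6 < 1 ^ 6 := pow_lt_pow_left₀ hq1 hq.le (by norm_num)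
      _ = 1 := one_pow 6
  have hden : 0 < 1 + q ^ 6 := by positivity
  have hs : s = 2 * q ^ 3 / (1 + q ^ 6) := by simp only [s]; ring
  have hs0 : 0 < s := by rw [hs]; positivity
  have hs1 : s < 1 := by
    rw [hs, div_lt_one hden]
    nlinarith [sq_nonneg (1 - q ^ 3), hq6, pow_pos hq 3]
  have h1s : 1 - s ^ 2 = ((1 - q ^ 6) / (1 + q ^ 6)) ^ 2 := by
    rw [hs]
    field_simp
    ring
  have hsqrt : Real.sqrt (1 - s ^ 2) = (1 - q ^ 6) / (1 + q ^ 6) := by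
    rw [h1s, Real.sqrt_sq (div_nonneg (by linarith) hden.le)]
  have hm : (1 - Real.sqrt (1 - s ^ 2)) / s = q ^ 3 := by
    rw [hsqrt, hs]
    field_simp
    ring
  have h3 : (3:ℕ) ≠ 0 := by norm_num
  have hA : (q ^ 3) ^ ((1:ℝ) / 3) = q := by
    rw [show ((1:ℝ) / 3) = ((3:ℕ)⁻¹ : ℝ) by norm_num, Real.pow_rpow_inv_natCast hq.le h3]
  have hB : (q ^ 3) ^ (-(1:ℝ) / 3) = q⁻¹ := by
    rw [show (-(1:ℝ) / 3) = -((3:ℕ)⁻¹ : ℝ) by norm_num, Real.rpow_neg (by positivity),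
      Real.pow_rpow_inv_natCast hq.le h3]
  refine ⟨hs0, hs1, hsqrt, hm, ?_⟩
  rw [hA, hB]
  have hq0 : q ≠ 0 := hq.ne'
  have h16 : (1 - q ^ 6) ≠ 0 := by linarith
  field_simp
  ring

/-- The substitution is strictly increasing on `[0,1]`. -/
theorem strictMonoOn_tailSubst :
    StrictMonoOn (fun r : ℝ => 2 * (r * Real.sqrt r) / (1 + r ^ 3)) (Icc 0 1) := by
  refine strictMonoOn_of_deriv_pos (convex_Icc 0 1) ?_ fun r hr => ?_
  · exact ((continuousOn_const.mul (continuousOn_id.mul Real.continuous_sqrt.continuousOn)).div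
      (by fun_prop) fun r hr => one_add_cube_ne_zero hr.1)
  · rw [interior_Icc] at hr
    set q := Real.sqrt r with hq
    have hq0 : 0 < q := Real.sqrt_pos.2 hr.1
    have hq1 : q < 1 := (Real.sqrt_lt' one_pos).2 (by simpa using hr.2)
    have hr2 : r = q ^ 2 := (Real.sq_sqrt hr.1.le).symm
    rw [hr2, (hasDerivAt_tailSubst hq0).deriv]
    have : q ^ 6 < 1 := by
      calc q ^ 6 < 1 ^ 6 := pow_lt_pow_left₀ hq1 hq0.le (by norm_num)
        _ = 1 := one_pow 6
    have h' : 0 < 1 - q ^ 6 := by linarith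
    positivity

/-- The substitution maps `(0,1)` onto `(0,1)` (`φ(0) = 0`, `φ(1) = 1`, intermediate values). -/
theorem image_tailSubst :
    (fun r : ℝ => 2 * (r * Real.sqrt r) / (1 + r ^ 3)) '' Ioo 0 1 = Ioo 0 1 := by
  set φ : ℝ → ℝ := fun r => 2 * (r * Real.sqrt r) / (1 + r ^ 3) with hφ
  have hφ0 : φ 0 = 0 := by simp [hφ]
  have hφ1 : φ 1 = 1 := by norm_num [hφ]
  have hcont : ContinuousOn φ (Icc 0 1) :=
    (continuousOn_const.mul (continuousOn_id.mul Real.continuous_sqrt.continuousOn)).div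
      (by fun_prop) fun r hr => one_add_cube_ne_zero hr.1
  apply Subset.antisymm
  · rintro _ ⟨w, hw, rfl⟩
    have hm : StrictMonoOn φ (Icc 0 1) := strictMonoOn_tailSubst
    refine ⟨?_, ?_⟩
    · have h := hm (left_mem_Icc.2 zero_le_one) (Ioo_subset_Icc_self hw) hw.1
      rwa [hφ0] at h
    · have h := hm (Ioo_subset_Icc_self hw) (right_mem_Icc.2 zero_le_one) hw.2
      rwa [hφ1] at h
  · intro y hy
    obtain ⟨w, hw, hwy⟩ : y ∈ φ '' Icc 0 1 := by
      have := intermediate_value_Icc zero_le_one hcont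
      rw [hφ0, hφ1] at this
      exact this (Ioo_subset_Icc_self hy)
    refine ⟨w, ⟨?_, ?_⟩, hwy⟩
    · rcases hw.1.lt_or_eq with h | h
      · exact h
      · exfalso; rw [← h, hφ0] at hwy; linarith [hy.1]
    · rcases hw.2.lt_or_eq with h | h
      · exact h
      · exfalso; rw [h, hφ1] at hwy; linarith [hy.2]

/-- The substitution is `ℚ`-semialgebraic on any `ℚ`-semialgebraic subset of `{r > 0}` (as a
function of `p 0`). -/
theorem isSemialgebraicFunOn_tailSubst {S : Set (Fin 1 → ℝ)} (hS : IsSemialgebraic ℚ S)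
    (hpos : ∀ p ∈ S, 0 ≤ p 0) :
    IsSemialgebraicFunOn ℚ S (fun p => 2 * (p 0 * Real.sqrt (p 0)) / (1 + p 0 ^ 3)) := by
  have hX : IsSemialgebraicFunOn ℚ S (fun p => p 0) :=
    (isSemialgebraicFunOn_aeval hS (X 0 : MvPolynomial (Fin 1) ℚ)).congr fun z _ => by simp
  have hsq : IsSemialgebraicFunOn ℚ S (fun p => Real.sqrt (p 0)) := IsSemialgebraicFunOn.sqrt_holds hX
  have h2 : IsSemialgebraicFunOn ℚ S (fun _ => (2:ℝ)) := by
    simpa using isSemialgebraicFunOn_const_of_isAlgebraic hS (isAlgebraic_nat (R := ℚ) (A := ℝ) 2)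
  have hnum : IsSemialgebraicFunOn ℚ S (fun p => 2 * (p 0 * Real.sqrt (p 0))) :=
    (IsSemialgebraicFunOn.mul_holds h2 (IsSemialgebraicFunOn.mul_holds hX hsq)).congr fun p _ => rfl
  have hden : IsSemialgebraicFunOn ℚ S (fun p => 1 + p 0 ^ 3) :=
    (isSemialgebraicFunOn_aeval hS (1 + X 0 ^ 3 : MvPolynomial (Fin 1) ℚ)).congr fun z _ => by simp
  exact (hnum.div hden fun p hp => one_add_cube_ne_zero (hpos p hp)).congr fun p _ => rfl

end Summit.KontsevichZagierPeriods.KontsevichZagierPeriods.Theorems.GKZLevelThree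

end
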